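/-
Copyright: statement-level skeleton of a published paper (lit-balaban cell, Phase-2 proof seat p25, gen 22). No proof
claims beyond what the kernel checks below.
-/
import Literature.MathematicalPhysics.QuantumFieldTheory.BalabanImbrieJaffe1984to88.BIJ88WalkGeometryZd
import Mathlib.Algebra.Order.Field.GeomSum
import Mathlib.Analysis.SpecialFunctions.Exp

/-!
# `BalabanImbrieJaffe1984to88.BIJ88WalkSiteSummabilityZd` — T. Bałaban, J. Imbrie, A. Jaffe, *Effective action and
cluster properties of the abelian Higgs model*, Commun. Math. Phys. **114** (1988) 257–315 [BalabanImbrieJaffe1988],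
Sect. 2 p. 264 [PDF 8], verbatim: *"a random walk expansion as in [6] can be used to prove that |C^{(k)}_Λ(u; x₁, x₂)|
≦ ce^{−c|x₁−x₂|}. (2.41) … The local part C^{(k)}_{Λ,loc}(u; x₁, x₂) … is bounded as in (2.41)."* ([6] (2.13): *"|j −
j′| = max_μ|j_μ − j′_μ|"*) — **THE SITE-SUMMABILITY LETTER ON `ℤ^d`** (p25 gen 22; support file for row C2.Claim@312's
member W6b′ `BIJ88WalkIneq312Split245Decay`, owner r16, referee ref-5; geometry in the dictionary of p36's
`BIJ88WalkGeometryZd`; nothing of record changed).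

The `ℓ¹` reading of (2.41) used by W6a′/W6b′ (`BIJ88WalkSplit245LettersDecay.colsum_le_of_decay`: column sums of a
kernel decaying like `K₀e^{−c₁d(x,y)}` are `≤ K₀·C_s`) needs the lattice constant `C_s ≥ Σ_x e^{−c₁d(x,y)}`.  Here it
is PROVED for sites embedded injectively in `ℤ^d` with the sup-distance of [6] (`BIJ88WalkGeometryZd.supDist`):
`Σ_x e^{−a·supDist(pos x, y)} ≤ (2/(1 − e^{−a/d}))^d` for `a > 0`, uniformly in `y` and in the (finite) site set —
by `e^{−a‖z‖_∞} ≤ Π_μ e^{−(a/d)|z_μ|}`, the product structure of `ℤ^d` (`Finset.prod_univ_sum`) and the one-dimensional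
geometric bound `Σ_{n ∈ U} q^{|n − c|} ≤ 2/(1 − q)` for any finite `U ⊂ ℤ` (`Mathlib`'s `geom_sum_Ico_le_of_lt_one`).

statement-level skeleton of published theorems with citation tags; proofs where landed; nothing here is a claim
about the Yang–Mills mass gap

PDF held: `paper:balaban1988-cmp114-bij-abelian-higgs-effective-action` (journal page = PDF page + 256); p. 264 = PDF 8.

CITATION HEADER (lean-in-tree rule).  lit-balaban cell (HOME `run/shared/lean/pub/lit-balaban/`), Phase 2, seat p25
gen 22; support of row **C2.Claim@312** (`HOME/lit-balaban-r16/ROWS-C2-part2.md`, owner r16, referee ref-5) and reader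
of row C2.Eq2.41 (owner r18).  USED BY NAME, nothing restated: `BIJ88WalkGeometryZd.{supDist, natAbs_le_supDist}` (p36).

## What is proved (0 `sorry`, standard axioms, no new `Prop` facts; theorems only, no definitions)

* `sum_pow_natAbs_sub_le` (one dimension: `Σ_{n∈U} q^{|n−c|} ≤ 2/(1−q)`), `exp_neg_supDist_le_prod`
  (`e^{−a·supDist z y} ≤ Π_μ (e^{−a/d})^{|z_μ−y_μ|}`), **`sum_exp_neg_supDist_le`** (the letter `C_s = (2/(1 − e^{−a/d}))^d`).
HONEST SCOPE: lattice geometry only ([folklore] estimates in [6]'s sup-metric); the identification of the §5.13 model's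
abstract sites with points of `ℤ^d` is NOT made here.  NOT summit progress; NOT continuum; NOT Clay.  Imports
`BIJ88WalkGeometryZd`, `Mathlib`; modifies nothing.
-/

namespace Literature.MathematicalPhysics.QuantumFieldTheory.BalabanImbrieJaffe1984to88.BIJ88WalkSiteSummabilityZd

open Finset
open BIJ88WalkGeometryZd

/-! ## §1  One dimension: a finite geometric sum around a centre -/

/-- **`Σ_{n ∈ U} q^{|n − c|} ≤ 2/(1 − q)`** for any finite `U ⊂ ℤ`, centre `c` and `0 ≤ q < 1`: on each side of `c` the
map `n ↦ |n − c|` is injective into `ℕ`, and `Σ_{k<N} q^k ≤ 1/(1 − q)`. [folklore] [cite: BalabanImbrieJaffe1988, (2.41) p.264] -/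
theorem sum_pow_natAbs_sub_le (U : Finset ℤ) (c : ℤ) {q : ℝ} (hq0 : 0 ≤ q) (hq1 : q < 1) :
    ∑ n ∈ U, q ^ (n - c).natAbs ≤ 2 / (1 - q) := by
  classical
  -- an injective piece is bounded by the full geometric series
  have key : ∀ V : Finset ℤ, Set.InjOn (fun n => (n - c).natAbs) V →
      ∑ n ∈ V, q ^ (n - c).natAbs ≤ 1 / (1 - q) := by
    intro V hV
    rw [← Finset.sum_image (f := fun k => q ^ k) hV]
    set I : Finset ℕ := V.image fun n => (n - c).natAbs with hI
    have hsub : I ⊆ range (I.sup id + 1) := fun k hk =>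
      Finset.mem_range.mpr (Nat.lt_succ_of_le (Finset.le_sup (f := id) hk))
    calc ∑ k ∈ I, q ^ k ≤ ∑ k ∈ range (I.sup id + 1), q ^ k :=
          Finset.sum_le_sum_of_subset_of_nonneg hsub fun k _ _ => pow_nonneg hq0 k
      _ ≤ q ^ 0 / (1 - q) := by rw [Finset.range_eq_Ico]; exact geom_sum_Ico_le_of_lt_one hq0 hq1
      _ = 1 / (1 - q) := by rw [pow_zero]
  -- split at the centre
  have hinjP : Set.InjOn (fun n => (n - c).natAbs) ↑(U.filter fun n => c ≤ n) := by
    intro n hn m hm h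
    have hn' : c ≤ n := (Finset.mem_filter.mp hn).2
    have hm' : c ≤ m := (Finset.mem_filter.mp hm).2
    rcases Int.natAbs_eq_natAbs_iff.mp h with h | h <;> omega
  have hinjN : Set.InjOn (fun n => (n - c).natAbs) ↑(U.filter fun n => ¬ c ≤ n) := by
    intro n hn m hm h
    have hn' : ¬ c ≤ n := (Finset.mem_filter.mp hn).2
    have hm' : ¬ c ≤ m := (Finset.mem_filter.mp hm).2
    rcases Int.natAbs_eq_natAbs_iff.mp h with h | h <;> omega
  rw [← Finset.sum_filter_add_sum_filter_not U (fun n => c ≤ n)]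
  calc _ ≤ 1 / (1 - q) + 1 / (1 - q) := add_le_add (key _ hinjP) (key _ hinjN)
    _ = 2 / (1 - q) := by ring

/-! ## §2  `ℤ^d`: the sup-distance profile is dominated by a product of coordinate profiles -/

variable {dd : ℕ}

/-- **`e^{−a·supDist z y} ≤ Π_μ (e^{−a/d})^{|z_μ − y_μ|}`** for `a ≥ 0`, `d ≥ 1`: each coordinate gap is `≤ supDist`
(p36's `natAbs_le_supDist`), so `Σ_μ (a/d)|z_μ − y_μ| ≤ a·supDist z y`. [folklore] [cite: BalabanImbrieJaffe1988, (2.41) p.264] -/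
theorem exp_neg_supDist_le_prod (hd : 0 < dd) {a : ℝ} (ha : 0 ≤ a) (z y : Fin dd → ℤ) :
    Real.exp (-(a * supDist z y)) ≤ ∏ μ, Real.exp (-(a / dd)) ^ (z μ - y μ).natAbs := by
  have hprod : ∏ μ, Real.exp (-(a / dd)) ^ (z μ - y μ).natAbs
      = Real.exp (∑ μ : Fin dd, -(a / dd) * ((z μ - y μ).natAbs : ℝ)) := by
    rw [Real.exp_sum]
    refine Finset.prod_congr rfl fun μ _ => ?_
    rw [← Real.exp_nat_mul, mul_comm]
  rw [hprod, Real.exp_le_exp]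
  have hle : ∑ μ : Fin dd, (a / dd) * ((z μ - y μ).natAbs : ℝ) ≤ ∑ _μ : Fin dd, (a / dd) * supDist z y :=
    Finset.sum_le_sum fun μ _ => mul_le_mul_of_nonneg_left (natAbs_le_supDist z y μ) (div_nonneg ha (Nat.cast_nonneg _))
  have hconst : ∑ _μ : Fin dd, (a / dd) * supDist z y = a * supDist z y := by
    rw [Finset.sum_const, Finset.card_univ, Fintype.card_fin, nsmul_eq_mul]
    have hd' : (dd : ℝ) ≠ 0 := by exact_mod_cast hd.ne'
    field_simp
  have hsum : ∑ μ : Fin dd, -(a / dd) * ((z μ - y μ).natAbs : ℝ) = -∑ μ : Fin dd, (a / dd) * ((z μ - y μ).natAbs : ℝ) := by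
    rw [← Finset.sum_neg_distrib]
    exact Finset.sum_congr rfl fun μ _ => by ring
  rw [hsum]
  linarith

/-! ## §3  The site-summability letter -/

/-- **THE SITE-SUMMABILITY LETTER ON `ℤ^d`**: for sites embedded injectively in `ℤ^d` (`pos`), the sup-distance of
[6] and a rate `a > 0`, `Σ_x e^{−a·supDist(pos x, y)} ≤ (2/(1 − e^{−a/d}))^d` for every `y ∈ ℤ^d` — uniformly in the
site set: the constant `C_s` of `BIJ88WalkSplit245LettersDecay.colsum_le_of_decay` /
`BIJ88WalkIneq312Split245Decay.ineq312_remainder_bdry_split245_decay_walks` in this dictionary.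
[cite: BalabanImbrieJaffe1988, (2.41) p.264] -/
theorem sum_exp_neg_supDist_le {S : Type} [Fintype S] (hd : 0 < dd) (pos : S → Fin dd → ℤ)
    (hpos : Function.Injective pos) {a : ℝ} (ha : 0 < a) (y : Fin dd → ℤ) :
    ∑ x, Real.exp (-(a * supDist (pos x) y)) ≤ (2 / (1 - Real.exp (-(a / dd)))) ^ dd := by
  classical
  set q : ℝ := Real.exp (-(a / dd)) with hq
  have hq0 : 0 ≤ q := (Real.exp_pos _).le
  have hq1 : q < 1 := Real.exp_lt_one_iff.mpr (neg_lt_zero.mpr (div_pos ha (by exact_mod_cast hd)))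
  set T : Finset (Fin dd → ℤ) := univ.image pos with hT
  -- the sum over sites is the sum over their (distinct) positions
  have h1 : ∑ x, Real.exp (-(a * supDist (pos x) y)) = ∑ z ∈ T, Real.exp (-(a * supDist z y)) := by
    rw [hT, Finset.sum_image fun x _ x' _ h => hpos h]
  -- positions lie in the product of their coordinate ranges
  have hsubT : T ⊆ Fintype.piFinset fun μ => T.image fun z => z μ := fun z hz =>
    Fintype.mem_piFinset.mpr fun μ => Finset.mem_image_of_mem (fun z => z μ) hz
  calc ∑ x, Real.exp (-(a * supDist (pos x) y))
      = ∑ z ∈ T, Real.exp (-(a * supDist z y)) := h1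
    _ ≤ ∑ z ∈ T, ∏ μ, q ^ (z μ - y μ).natAbs :=
        Finset.sum_le_sum fun z _ => exp_neg_supDist_le_prod hd ha.le z y
    _ ≤ ∑ z ∈ Fintype.piFinset (fun μ => T.image fun z => z μ), ∏ μ, q ^ (z μ - y μ).natAbs :=
        Finset.sum_le_sum_of_subset_of_nonneg hsubT fun z _ _ => Finset.prod_nonneg fun μ _ => pow_nonneg hq0 _
    _ = ∏ μ, ∑ n ∈ T.image (fun z => z μ), q ^ (n - y μ).natAbs :=
        (Finset.prod_univ_sum (fun μ => T.image fun z => z μ) fun μ n => q ^ (n - y μ).natAbs).symm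
    _ ≤ ∏ _μ : Fin dd, 2 / (1 - q) :=
        Finset.prod_le_prod (fun μ _ => Finset.sum_nonneg fun n _ => pow_nonneg hq0 _)
          fun μ _ => sum_pow_natAbs_sub_le _ _ hq0 hq1
    _ = (2 / (1 - q)) ^ dd := by rw [Finset.prod_const, Finset.card_univ, Fintype.card_fin]

end Literature.MathematicalPhysics.QuantumFieldTheory.BalabanImbrieJaffe1984to88.BIJ88WalkSiteSummabilityZd
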